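import Mathlib
import HarnessLib

/-!
# Nesterenko's linear independence criterion (exact-rate form)

Topic `Literature/NumberTheory/Transcendental`. The criterion of Yu. V. Nesterenko (1985) in the
form in which T. Rivoal uses it for the Ball–Rivoal theorem (`PeriodsWave0.lean`, **periods.S19**,
`Literature.NumberTheory.Transcendental.ball_rivoal`), as printed in [Rivoal2000, §1, "Critère
d'indépendance linéaire"]:

> Considérons `N` réels `θ₁, …, θ_N` et supposons qu'il existe `N` suites d'entiers `(p_{i,n})_{n ≥ 0}`
> tels que : i) `log |∑ᵢ p_{i,n} θᵢ| = n log(α) + o(n)` avec `0 < α < 1` ;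
> ii) `∀ i, log |p_{i,n}| ≤ n log(β) + o(n)` avec `β > 1`.
> Dans ces conditions, `dim_ℚ(ℚθ₁ + ⋯ + ℚθ_N) ≥ 1 − log(α)/log(β)`.

This is `nesterenko_criterion` below, fully PROVED (no named facts in this file). Hypothesis i) is
rendered as `log |∑ᵢ p_{i,n} θᵢ| / n → log α`, hypothesis ii) as
`∀ i, ∀ ε > 0, ∀ᶠ n, log |p_{i,n}| ≤ n log β + ε n`.

## Proof

Not Nesterenko's original argument (Vestnik MGU 1985, an induction over sublattices) but the
short duality ("transference") argument available in the exact-rate case i), which is the case of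
all applications to zeta values (cf. the remarks in S. Fischler, W. Zudilin, *A refinement of
Nesterenko's linear independence criterion with applications to zeta values*, Math. Ann. 347
(2010), where the exact-rate case is likewise given a short proof):

1. Reduction (`nesterenko_criterion`): choose a `ℚ`-basis `e₀, …, e_m` of the span (`m + 1 = dim`),
   rewrite the forms with integer coefficients in the basis (common denominator of the coordinates),
   and divide by `e₀ ≠ 0`; one obtains integer forms `p₀,ₙ + ∑_{t<m} p_{t,n} ξ_t` with the same rates.
2. Core (`NesterenkoCriterion.core`): if `p₀,ₙ + ∑ₜ p_{t,n} ξₜ = L_n` with `log|L_n|/n → −A`,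
   `|p_{t,n}| ≤ e^{(B+ε)n}`, then `A ≤ m B`. Indeed (`mul_abs_le_mul_distSum`) for every integer
   `q ≥ 1` with `q|L_n| < 1/2` one has `q |L_n| ≤ e^{(B+δ)n} Ψ(q)` where
   `Ψ(q) = ∑ₜ |qξₜ − round(qξₜ)|` (the integer `q p₀,ₙ + ∑ p_{t,n} round(qξₜ)` is either `0` or of
   modulus `≥ 1`); taking `n ≈ log(2q)/(A−δ)` gives `Ψ(q) ≥ e^{−C₀} q^{−(B+3δ)/(A−δ)}` for all large
   `q`, in particular `Ψ(q) > 0`; but the simultaneous Dirichlet box principle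
   (`exists_simultaneous_approx`) gives `q ≤ Q^m` with `Ψ(q) ≤ m/Q`, and if `m(B+3δ) < A − δ` these
   `q` stay bounded as `Q → ∞`, forcing `Ψ(q*) = 0` for some `q* ≥ 1`, hence `Ψ(k q*) = 0` for all
   `k`, a contradiction.

## References

* [Rivoal2000] T. Rivoal, *La fonction zêta de Riemann prend une infinité de valeurs
  irrationnelles aux entiers impairs*, C. R. Acad. Sci. Paris Sér. I 331 (2000) 267–270,
  arXiv:math/0008051, §1 (statement of the criterion, attributed to [6] = Nesterenko 1985).
* Yu. V. Nesterenko, *On the linear independence of numbers*, Vestnik Moskov. Univ. Ser. I (1985)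
  no. 1, 46–54; Moscow Univ. Math. Bull. 40 (1985) 69–74 (the original criterion).
* S. Fischler, W. Zudilin, Math. Ann. 347 (2010) 739–763 (refinement; short proof in the
  exact-rate case).
-/

noncomputable section

open Filter Topology Finset

namespace Literature.NumberTheory.Transcendental

namespace NesterenkoCriterion

/-! ### Simultaneous approximation: the box principle -/

/-- `Ψ(q) = ∑ₜ |q ξₜ − round(q ξₜ)|`, the total distance of `(qξₜ)ₜ` to `ℤ^m`. [folklore] -/
def distSum {m : ℕ} (ξ : Fin m → ℝ) (q : ℕ) : ℝ :=
  ∑ i, |(q : ℝ) * ξ i - round ((q : ℝ) * ξ i)|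

/-- `Ψ(q) ≥ 0`. [folklore] -/
theorem distSum_nonneg {m : ℕ} (ξ : Fin m → ℝ) (q : ℕ) : 0 ≤ distSum ξ q :=
  sum_nonneg fun _ _ => abs_nonneg _

/-- **Dirichlet's simultaneous approximation theorem** (box principle): for reals `ξ₀, …, ξ_{m-1}`
and an integer `Q ≥ 1` there is an integer `1 ≤ q ≤ Q^m` with `|qξₜ − round(qξₜ)| < 1/Q` for every
`t` (pigeonhole on the `Q^m + 1` points `({jξₜ})ₜ`, `0 ≤ j ≤ Q^m`, in the `Q^m` boxes of side `1/Q`).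
Mathlib has the case `m = 1` (`Real.exists_int_int_abs_mul_sub_le`). [folklore] -/
theorem exists_simultaneous_approx {m : ℕ} (ξ : Fin m → ℝ) {Q : ℕ} (hQ : 0 < Q) :
    ∃ q : ℕ, 0 < q ∧ q ≤ Q ^ m ∧ ∀ i, |(q : ℝ) * ξ i - round ((q : ℝ) * ξ i)| < 1 / Q := by
  classical
  have hQr : (0 : ℝ) < Q := by exact_mod_cast hQ
  have hfl : ∀ (j : ℕ) (i : Fin m), ⌊Int.fract ((j : ℝ) * ξ i) * Q⌋₊ < Q := fun j i => by
    rw [Nat.floor_lt (mul_nonneg (Int.fract_nonneg _) hQr.le)]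
    calc Int.fract ((j : ℝ) * ξ i) * Q < 1 * Q := by
          gcongr
          exact Int.fract_lt_one _
      _ = Q := one_mul _
  let f : Fin (Q ^ m + 1) → Fin m → Fin Q := fun j i =>
    ⟨⌊Int.fract (((j : ℕ) : ℝ) * ξ i) * Q⌋₊, hfl j i⟩
  have hcard : Fintype.card (Fin m → Fin Q) < Fintype.card (Fin (Q ^ m + 1)) := by
    simp only [Fintype.card_fun, Fintype.card_fin]
    exact Nat.lt_succ_self _
  obtain ⟨x, y, hne, hxy⟩ := Fintype.exists_ne_map_eq_of_card_lt f hcard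
  have key : ∀ x y : Fin (Q ^ m + 1), (x : ℕ) < y → f x = f y →
      ∃ q : ℕ, 0 < q ∧ q ≤ Q ^ m ∧ ∀ i, |(q : ℝ) * ξ i - round ((q : ℝ) * ξ i)| < 1 / Q := by
    intro x y hlt hfxy
    refine ⟨(y : ℕ) - x, Nat.sub_pos_of_lt hlt, ?_, fun i => ?_⟩
    · have hy : (y : ℕ) ≤ Q ^ m := Nat.lt_succ_iff.1 y.isLt
      omega
    · have h : ⌊Int.fract (((x : ℕ) : ℝ) * ξ i) * Q⌋₊ = ⌊Int.fract (((y : ℕ) : ℝ) * ξ i) * Q⌋₊ := by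
        have := congrFun hfxy i
        simp only [f, Fin.mk.injEq] at this
        exact this
      set u := Int.fract (((x : ℕ) : ℝ) * ξ i) * Q with hu
      set v := Int.fract (((y : ℕ) : ℝ) * ξ i) * Q with hv
      have hu0 : 0 ≤ u := mul_nonneg (Int.fract_nonneg _) hQr.le
      have hv0 : 0 ≤ v := mul_nonneg (Int.fract_nonneg _) hQr.le
      have h1 := (Nat.floor_eq_iff hu0).1 h
      have h2 := Nat.floor_le hv0
      have h3 := Nat.lt_floor_add_one v
      have huv : |v - u| < 1 := by
        rw [abs_sub_lt_iff]
        constructor <;> linarith [h1.1, h1.2]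
      have hz : (((y : ℕ) - x : ℕ) : ℝ) * ξ i -
            ((⌊((y : ℕ) : ℝ) * ξ i⌋ - ⌊((x : ℕ) : ℝ) * ξ i⌋ : ℤ) : ℝ)
          = Int.fract (((y : ℕ) : ℝ) * ξ i) - Int.fract (((x : ℕ) : ℝ) * ξ i) := by
        rw [Nat.cast_sub hlt.le]
        simp only [Int.fract, Int.cast_sub]
        ring
      calc |(((y : ℕ) - x : ℕ) : ℝ) * ξ i - round ((((y : ℕ) - x : ℕ) : ℝ) * ξ i)|
          ≤ |(((y : ℕ) - x : ℕ) : ℝ) * ξ i -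
              ((⌊((y : ℕ) : ℝ) * ξ i⌋ - ⌊((x : ℕ) : ℝ) * ξ i⌋ : ℤ) : ℝ)| := round_le _ _
        _ = |Int.fract (((y : ℕ) : ℝ) * ξ i) - Int.fract (((x : ℕ) : ℝ) * ξ i)| := by rw [hz]
        _ = |v - u| / Q := by
            rw [hu, hv, ← sub_mul, abs_mul, abs_of_pos hQr, mul_div_cancel_right₀ _ hQr.ne']
        _ < 1 / Q := by gcongr
  rcases lt_or_gt_of_ne (fun h : (x : ℕ) = y => hne (Fin.ext h)) with hlt | hlt
  · exact key x y hlt hxy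
  · exact key y x hlt hxy.symm

/-- `Ψ(q) ≤ m/Q` for the `q ≤ Q^m` of `exists_simultaneous_approx`. [folklore] -/
theorem exists_distSum_le {m : ℕ} (ξ : Fin m → ℝ) {Q : ℕ} (hQ : 0 < Q) :
    ∃ q : ℕ, 0 < q ∧ q ≤ Q ^ m ∧ distSum ξ q ≤ m / Q := by
  obtain ⟨q, hq, hqQ, hqi⟩ := exists_simultaneous_approx ξ hQ
  refine ⟨q, hq, hqQ, ?_⟩
  calc distSum ξ q ≤ ∑ _i : Fin m, (1 : ℝ) / Q := sum_le_sum fun i _ => (hqi i).le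
    _ = m / Q := by simp [sum_const, div_eq_mul_inv]

/-! ### The key inequality: small forms force `Ψ(q)` away from `0` -/

/-- **Lemma A.** Let `L = p₀ + ∑ₜ pₜ ξₜ` with integers `p₀, pₜ`, `|pₜ| ≤ M`, and let `q ≥ 1` be an
integer with `q |L| < 1/2`. Then `q |L| ≤ M Ψ(q)`. Indeed `Z = q p₀ + ∑ₜ pₜ round(qξₜ) ∈ ℤ`
satisfies `|qL − Z| ≤ M Ψ(q)`; if `Z = 0` we are done, and if `Z ≠ 0` then
`1 ≤ |Z| < 1/2 + M Ψ(q)`, so `M Ψ(q) > 1/2 > q|L|`. [folklore] -/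
theorem mul_abs_le_mul_distSum {m : ℕ} (ξ : Fin m → ℝ) (p₀ : ℤ) (p : Fin m → ℤ) {M : ℝ}
    (hp : ∀ i, |(p i : ℝ)| ≤ M) {q : ℕ}
    (hq : (q : ℝ) * |(p₀ : ℝ) + ∑ i, (p i : ℝ) * ξ i| < 1 / 2) :
    (q : ℝ) * |(p₀ : ℝ) + ∑ i, (p i : ℝ) * ξ i| ≤ M * distSum ξ q := by
  set L := (p₀ : ℝ) + ∑ i, (p i : ℝ) * ξ i with hL
  set Z : ℤ := q * p₀ + ∑ i, p i * round ((q : ℝ) * ξ i) with hZ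
  have hdiff : (q : ℝ) * L - Z = ∑ i, (p i : ℝ) * ((q : ℝ) * ξ i - round ((q : ℝ) * ξ i)) := by
    rw [hL, hZ]
    push_cast
    rw [mul_add, mul_sum, add_sub_add_comm, sub_self, zero_add, ← sum_sub_distrib]
    exact sum_congr rfl fun i _ => by ring
  have hbound : |(q : ℝ) * L - Z| ≤ M * distSum ξ q := by
    rw [hdiff, distSum, mul_sum]
    refine (abs_sum_le_sum_abs _ _).trans (sum_le_sum fun i _ => ?_)
    rw [abs_mul]
    exact mul_le_mul_of_nonneg_right (hp i) (abs_nonneg _)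
  have hqL : (q : ℝ) * |L| = |(q : ℝ) * L| := by
    rw [abs_mul, Nat.abs_cast]
  by_cases hZ0 : Z = 0
  · rw [hqL]
    simpa [hZ0] using hbound
  · have h1 : (1 : ℝ) ≤ |(Z : ℝ)| := by
      rw [← Int.cast_abs]
      exact_mod_cast Int.one_le_abs hZ0
    have h2 : |(Z : ℝ)| ≤ |(q : ℝ) * L - Z| + |(q : ℝ) * L| := by
      have := abs_sub_abs_le_abs_sub (Z : ℝ) ((q : ℝ) * L)
      rw [abs_sub_comm] at this
      linarith
    rw [hqL] at hq ⊢
    linarith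

/-! ### The core: forms with exact rate in `m + 1` numbers `1, ξ₀, …, ξ_{m-1}` force `A ≤ m B` -/

/-- **Core of the criterion (no independence hypothesis).** Let `ξ : Fin m → ℝ` and integer
sequences `p₀,ₙ`, `p_{t,n}` with `L_n = p₀,ₙ + ∑ₜ p_{t,n} ξₜ`, `log |L_n| / n → −A` (`A > 0`) and,
for every `ε > 0`, `|p_{t,n}| ≤ e^{(B + ε) n}` for all large `n` (`B ≥ 0`). Then `A ≤ m B`.
(With `m + 1 = dim` this is `dim ≥ 1 + A/B = 1 − log α / log β`.) [folklore] -/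
theorem core {m : ℕ} (ξ : Fin m → ℝ) (p₀ : ℕ → ℤ) (p : ℕ → Fin m → ℤ) {A B : ℝ}
    (hA : 0 < A) (hB : 0 ≤ B)
    (hL : Tendsto (fun n : ℕ => Real.log |(p₀ n : ℝ) + ∑ i, (p n i : ℝ) * ξ i| / n)
      atTop (𝓝 (-A)))
    (hp : ∀ ε : ℝ, 0 < ε → ∀ᶠ n : ℕ in atTop, ∀ i, |(p n i : ℝ)| ≤ Real.exp ((B + ε) * n)) :
    A ≤ m * B := by
  by_contra hcon
  push Not at hcon
  set L : ℕ → ℝ := fun n => (p₀ n : ℝ) + ∑ i, (p n i : ℝ) * ξ i with hLdef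
  -- the parameter `δ`
  set δ : ℝ := (A - m * B) / (2 * (3 * m + 1)) with hδ
  have hm0 : (0 : ℝ) ≤ m := Nat.cast_nonneg m
  have h3m : (0 : ℝ) < 2 * (3 * m + 1) := by positivity
  have hδpos : 0 < δ := by
    rw [hδ]
    exact div_pos (by linarith) h3m
  have hkey : (3 * m + 1) * δ = (A - m * B) / 2 := by
    rw [hδ]
    field_simp
  have hδA : δ < A := by nlinarith
  have hκ : m * (B + 3 * δ) < A - δ := by nlinarith
  have hAδ : 0 < A - δ := by linarith
  -- Step 0: eventual two-sided bounds for `L n` and bounds for the coefficients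
  have hev : ∀ᶠ n : ℕ in atTop,
      (Real.exp (-(A + δ) * n) ≤ |L n| ∧ |L n| ≤ Real.exp (-(A - δ) * n)) ∧
        ∀ i, |(p n i : ℝ)| ≤ Real.exp ((B + δ) * n) := by
    have h1 : ∀ᶠ n : ℕ in atTop, Real.log |L n| / n ∈ Set.Ioo (-A - δ) (-A + δ) :=
      hL.eventually (Ioo_mem_nhds (by linarith) (by linarith))
    filter_upwards [h1, hp δ hδpos, eventually_gt_atTop 0] with n hn hpn hn0
    refine ⟨?_, hpn⟩
    have hnr : (0 : ℝ) < n := by exact_mod_cast hn0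
    rw [Set.mem_Ioo, lt_div_iff₀ hnr, div_lt_iff₀ hnr] at hn
    have hne : L n ≠ 0 := by
      intro h0
      rw [h0, abs_zero, Real.log_zero] at hn
      have : (-A + δ) * n < 0 := mul_neg_of_neg_of_pos (by linarith) hnr
      linarith [hn.2]
    have hpos : 0 < |L n| := abs_pos.2 hne
    refine ⟨?_, ?_⟩
    · rw [← Real.exp_log hpos, Real.exp_le_exp]
      nlinarith [hn.1]
    · rw [← Real.exp_log hpos, Real.exp_le_exp]
      nlinarith [hn.2]
  obtain ⟨n₀, hn₀⟩ := eventually_atTop.1 hev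
  -- Step 2: an explicit lower bound for `Ψ(q)`, `q` large
  set K : ℝ := (A + B + 2 * δ) / (A - δ) with hK
  set C₀ : ℝ := K * Real.log 2 + (A + B + 2 * δ) with hC₀
  have hK0 : 0 ≤ K - 1 := by
    rw [hK, sub_nonneg, le_div_iff₀ hAδ]
    linarith
  have hK1 : m * (K - 1) < 1 := by
    have : m * (K - 1) = m * (B + 3 * δ) / (A - δ) := by
      rw [hK]
      field_simp
      ring
    rw [this, div_lt_one hAδ]
    exact hκ
  obtain ⟨q₀, hq₀⟩ : ∃ q₀ : ℕ, ∀ q : ℕ, q₀ ≤ q →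
      Real.exp (-((K - 1) * Real.log q + C₀)) ≤ distSum ξ q := by
    refine ⟨⌈Real.exp ((A - δ) * n₀)⌉₊, fun q hq => ?_⟩
    have hq1 : Real.exp ((A - δ) * n₀) ≤ q := (Nat.le_ceil _).trans (by exact_mod_cast hq)
    have hqpos : (0 : ℝ) < q := (Real.exp_pos _).trans_le hq1
    have hlogq : (A - δ) * n₀ ≤ Real.log q := by
      rw [← Real.log_exp ((A - δ) * n₀)]
      exact Real.log_le_log (Real.exp_pos _) hq1
    have hq1' : (1 : ℝ) ≤ q := by
      have : 0 < q := by exact_mod_cast hqpos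
      exact_mod_cast this
    have h2qpos : (0 : ℝ) < 2 * q := by linarith
    have hlog2q : 0 ≤ Real.log (2 * q) := Real.log_nonneg (by linarith)
    have hlog2q' : Real.log (2 * q) = Real.log 2 + Real.log q :=
      Real.log_mul (by norm_num) hqpos.ne'
    set x : ℝ := Real.log (2 * q) / (A - δ) with hx
    have hx0 : 0 ≤ x := div_nonneg hlog2q hAδ.le
    set n : ℕ := ⌊x⌋₊ + 1 with hn
    have hn_gt : x < n := by
      rw [hn]
      push_cast
      exact Nat.lt_floor_add_one x
    have hn_le : (n : ℝ) ≤ x + 1 := by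
      rw [hn]
      push_cast
      linarith [Nat.floor_le hx0]
    have hn₀n : n₀ ≤ n := by
      have h2q : Real.log q ≤ Real.log (2 * q) := Real.log_le_log hqpos (by linarith)
      have h' : (n₀ : ℝ) ≤ x := by
        rw [hx, le_div_iff₀ hAδ]
        linarith
      have : (n₀ : ℝ) < n := h'.trans_lt hn_gt
      exact_mod_cast this.le
    obtain ⟨⟨hlow, hupp⟩, hpn⟩ := hn₀ n hn₀n
    -- `q |L n| < 1/2`
    have hsmall : (q : ℝ) * |L n| < 1 / 2 := by
      have hlt : Real.log (2 * q) < (A - δ) * n := by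
        have := hn_gt
        rwa [hx, div_lt_iff₀' hAδ] at this
      have h2 : 2 * (q : ℝ) < Real.exp ((A - δ) * n) := by
        rw [← Real.exp_log h2qpos]
        exact Real.exp_lt_exp.2 hlt
      have h3 : (q : ℝ) * Real.exp (-(A - δ) * n) < 1 / 2 := by
        rw [show -(A - δ) * (n : ℝ) = -((A - δ) * n) by ring, Real.exp_neg]
        rw [← div_eq_mul_inv, div_lt_iff₀ (Real.exp_pos _)]
        linarith
      calc (q : ℝ) * |L n| ≤ q * Real.exp (-(A - δ) * n) := by gcongr
        _ < 1 / 2 := h3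
    have hA' := mul_abs_le_mul_distSum ξ (p₀ n) (p n) hpn hsmall
    -- the chain of inequalities
    have hA'' : (q : ℝ) * |L n| ≤ Real.exp ((B + δ) * n) * distSum ξ q := hA'
    have hΨ : (q : ℝ) * |L n| * Real.exp (-((B + δ) * n)) ≤ distSum ξ q := by
      rw [Real.exp_neg, ← div_eq_mul_inv, div_le_iff₀ (Real.exp_pos _)]
      exact hA''.trans_eq (mul_comm _ _)
    have hchain : Real.exp (-((K - 1) * Real.log q + C₀)) ≤
        (q : ℝ) * Real.exp (-(A + δ) * n) * Real.exp (-((B + δ) * n)) := by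
      have hrw : (q : ℝ) * Real.exp (-(A + δ) * n) * Real.exp (-((B + δ) * n)) =
          Real.exp (Real.log q + -(A + δ) * n + -((B + δ) * n)) := by
        rw [Real.exp_add, Real.exp_add, Real.exp_log hqpos]
      rw [hrw, Real.exp_le_exp]
      have hABd : 0 ≤ A + B + 2 * δ := by linarith
      have hnK : (A + B + 2 * δ) * n ≤ K * Real.log 2 + K * Real.log q + (A + B + 2 * δ) := by
        calc (A + B + 2 * δ) * n ≤ (A + B + 2 * δ) * (x + 1) := by gcongr
          _ = K * Real.log 2 + K * Real.log q + (A + B + 2 * δ) := by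
              rw [hx, hlog2q', hK]
              field_simp
      rw [hC₀]
      linarith
    calc Real.exp (-((K - 1) * Real.log q + C₀))
        ≤ (q : ℝ) * Real.exp (-(A + δ) * n) * Real.exp (-((B + δ) * n)) := hchain
      _ ≤ (q : ℝ) * |L n| * Real.exp (-((B + δ) * n)) := by gcongr
      _ ≤ distSum ξ q := hΨ
  -- Step 3: for `Q` large, every denominator given by the box principle is `< q₀`
  obtain ⟨Q₁, hQ₁pos, hQ₁⟩ : ∃ Q₁ : ℕ, 0 < Q₁ ∧ ∀ Q : ℕ, Q₁ ≤ Q → ∀ q : ℕ, 0 < q →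
      q ≤ Q ^ m → distSum ξ q ≤ m / Q → q < q₀ := by
    rcases Nat.eq_zero_or_pos m with hm | hm
    · refine ⟨1, one_pos, fun Q _ q _ _ hΨ => ?_⟩
      by_contra h
      push Not at h
      have h1 := hq₀ q h
      have h2 : (0 : ℝ) < distSum ξ q := (Real.exp_pos _).trans_le h1
      subst hm
      simp only [CharP.cast_eq_zero, zero_div] at hΨ
      linarith
    · set T : ℝ := (Real.log m + C₀) / (1 - m * (K - 1)) with hT
      refine ⟨⌈Real.exp T⌉₊ + 1, Nat.succ_pos _, fun Q hQ q hq hqQ hΨ => ?_⟩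
      by_contra h
      push Not at h
      have hstep := hq₀ q h
      have hQr : Real.exp T < Q := by
        have : (⌈Real.exp T⌉₊ : ℝ) + 1 ≤ Q := by exact_mod_cast hQ
        linarith [Nat.le_ceil (Real.exp T)]
      have hQpos : (0 : ℝ) < Q := (Real.exp_pos _).trans hQr
      have hqpos : (0 : ℝ) < q := by exact_mod_cast hq
      have hmr : (0 : ℝ) < m := by exact_mod_cast hm
      have hlogq : Real.log q ≤ m * Real.log Q := by
        rw [← Real.log_pow]
        exact Real.log_le_log hqpos (by exact_mod_cast hqQ)
      have h1 : Real.exp (-((K - 1) * (m * Real.log Q) + C₀)) ≤ m / Q := by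
        refine le_trans ?_ (hstep.trans hΨ)
        rw [Real.exp_le_exp]
        nlinarith [mul_le_mul_of_nonneg_left hlogq hK0]
      have h2 : (1 - m * (K - 1)) * Real.log Q ≤ Real.log m + C₀ := by
        have h1' : Real.exp (-((K - 1) * (m * Real.log Q) + C₀)) * Q ≤ m := by
          rwa [le_div_iff₀ hQpos] at h1
        have hpos1 : 0 < Real.exp (-((K - 1) * (m * Real.log Q) + C₀)) * Q := by positivity
        have h3 : Real.log (Real.exp (-((K - 1) * (m * Real.log Q) + C₀)) * Q) ≤ Real.log m :=
          Real.log_le_log hpos1 h1'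
        rw [Real.log_mul (Real.exp_pos _).ne' hQpos.ne', Real.log_exp] at h3
        linarith
      have h4 : T < Real.log Q := by
        rw [← Real.log_exp T]
        exact Real.log_lt_log (Real.exp_pos _) hQr
      have h5 : 0 < 1 - m * (K - 1) := by linarith
      rw [hT, div_lt_iff₀ h5] at h4
      nlinarith
  -- Step 4: some `q* ≥ 1` has `Ψ(q*) = 0`
  obtain ⟨qs, hqs, hqs0⟩ : ∃ q : ℕ, 0 < q ∧ distSum ξ q = 0 := by
    by_contra hnone
    push Not at hnone
    have hSpos : ∀ q ∈ Finset.Ico 1 q₀, 0 < distSum ξ q := fun q hq =>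
      lt_of_le_of_ne (distSum_nonneg ξ q) (hnone q (Finset.mem_Ico.1 hq).1).symm
    obtain ⟨μ, hμ, hμS⟩ : ∃ μ : ℝ, 0 < μ ∧ ∀ q ∈ Finset.Ico 1 q₀, μ ≤ distSum ξ q := by
      by_cases hS : (Finset.Ico 1 q₀).Nonempty
      · obtain ⟨q₁, hq₁, hmin⟩ := Finset.exists_min_image (Finset.Ico 1 q₀) (distSum ξ) hS
        exact ⟨distSum ξ q₁, hSpos q₁ hq₁, hmin⟩
      · exact ⟨1, one_pos, fun q hq => (hS ⟨q, hq⟩).elim⟩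
    set Q : ℕ := max Q₁ (⌈(m : ℝ) / μ⌉₊ + 1) with hQdef
    have hQ₁Q : Q₁ ≤ Q := le_max_left _ _
    have hQpos : 0 < Q := lt_of_lt_of_le hQ₁pos hQ₁Q
    have hQpos' : (0 : ℝ) < Q := by exact_mod_cast hQpos
    have hmQ : (m : ℝ) / Q < μ := by
      have hQr : (⌈(m : ℝ) / μ⌉₊ : ℝ) + 1 ≤ Q := by
        have : ⌈(m : ℝ) / μ⌉₊ + 1 ≤ Q := le_max_right _ _
        exact_mod_cast this
      rw [div_lt_iff₀ hQpos']
      calc (m : ℝ) = (m / μ) * μ := by field_simp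
        _ ≤ ⌈(m : ℝ) / μ⌉₊ * μ := by gcongr; exact Nat.le_ceil _
        _ < Q * μ := by
            have h : (⌈(m : ℝ) / μ⌉₊ : ℝ) < Q := by linarith
            exact mul_lt_mul_of_pos_right h hμ
        _ = μ * Q := mul_comm _ _
    obtain ⟨q, hq, hqQ, hΨ⟩ := exists_distSum_le ξ hQpos
    have hlt : q < q₀ := hQ₁ Q hQ₁Q q hq hqQ hΨ
    have hmem : q ∈ Finset.Ico 1 q₀ := Finset.mem_Ico.2 ⟨hq, hlt⟩
    have := hμS q hmem
    linarith
  -- Step 5: then every multiple of `q*` has `Ψ = 0`, contradicting Step 2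
  have hround : ∀ i, (qs : ℝ) * ξ i = round ((qs : ℝ) * ξ i) := by
    intro i
    have h := (sum_eq_zero_iff_of_nonneg (fun i _ => abs_nonneg _)).1 hqs0 i (mem_univ i)
    have := abs_eq_zero.1 h
    linarith
  have hzero : distSum ξ (q₀ * qs) = 0 := by
    refine sum_eq_zero fun i _ => ?_
    rw [abs_eq_zero, sub_eq_zero]
    have : ((q₀ * qs : ℕ) : ℝ) * ξ i = ((q₀ * round ((qs : ℝ) * ξ i) : ℤ) : ℝ) := by
      push_cast
      rw [mul_assoc]
      congr 1
      exact hround i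
    rw [this, round_intCast]
  have hge : q₀ ≤ q₀ * qs := Nat.le_mul_of_pos_right _ hqs
  have := hq₀ (q₀ * qs) hge
  rw [hzero] at this
  exact absurd this (not_le.2 (Real.exp_pos _))

end NesterenkoCriterion

/-! ### The criterion as printed -/

open NesterenkoCriterion in
/-- **Nesterenko's linear independence criterion** (Nesterenko 1985), in the exact-rate form used
by Rivoal [Rivoal2000, §1]: let `θ₁, …, θ_N` be real numbers and `(p_{i,n})` `N` sequences of
integers such that i) `log |∑ᵢ p_{i,n} θᵢ| = n log α + o(n)` with `0 < α < 1` (here: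
`log |∑ᵢ p_{i,n} θᵢ| / n → log α`) and ii) `log |p_{i,n}| ≤ n log β + o(n)` with `β > 1` (here: for
every `i` and every `ε > 0`, `log |p_{i,n}| ≤ n log β + ε n` for all large `n`). Then
`dim_ℚ (ℚθ₁ + ⋯ + ℚθ_N) ≥ 1 − log α / log β`.
[cite: Rivoal2000, §1 Critère d'indépendance linéaire] -/
theorem nesterenko_criterion {N : ℕ} (θ : Fin N → ℝ) (p : ℕ → Fin N → ℤ) {α β : ℝ}
    (hα : 0 < α) (hα1 : α < 1) (hβ : 1 < β)
    (h1 : Tendsto (fun n : ℕ => Real.log |∑ i, (p n i : ℝ) * θ i| / n) atTop (𝓝 (Real.log α)))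
    (h2 : ∀ i, ∀ ε : ℝ, 0 < ε →
      ∀ᶠ n : ℕ in atTop, Real.log |(p n i : ℝ)| ≤ n * Real.log β + ε * n) :
    1 - Real.log α / Real.log β ≤ (Module.finrank ℚ (Submodule.span ℚ (Set.range θ)) : ℝ) := by
  classical
  set V := Submodule.span ℚ (Set.range θ) with hV
  haveI : FiniteDimensional ℚ V := FiniteDimensional.span_of_finite ℚ (Set.finite_range θ)
  set A : ℝ := -Real.log α with hAdef
  set B : ℝ := Real.log β with hBdef
  have hA : 0 < A := neg_pos.2 (Real.log_neg hα hα1)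
  have hB : 0 < B := Real.log_pos hβ
  set L : ℕ → ℝ := fun n => ∑ i, (p n i : ℝ) * θ i with hLdef
  -- `L n ≠ 0` for large `n`
  have hLne : ∀ᶠ n in atTop, L n ≠ 0 := by
    have h1' : ∀ᶠ n : ℕ in atTop, Real.log |L n| / n ∈ Set.Iio (Real.log α / 2) :=
      h1.eventually (Iio_mem_nhds (by linarith))
    filter_upwards [h1', eventually_gt_atTop 0] with n hn hn0 h0
    have hnr : (0 : ℝ) < n := by exact_mod_cast hn0
    rw [Set.mem_Iio, h0, abs_zero, Real.log_zero, zero_div] at hn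
    linarith
  obtain ⟨n₁, hn₁⟩ := hLne.exists
  have hθne : ∃ i, θ i ≠ 0 := by
    by_contra h
    push Not at h
    apply hn₁
    simp [hLdef, h]
  have hd : 0 < Module.finrank ℚ V := by
    rw [Module.finrank_pos_iff_exists_ne_zero]
    obtain ⟨i, hi⟩ := hθne
    refine ⟨⟨θ i, Submodule.subset_span ⟨i, rfl⟩⟩, ?_⟩
    intro h
    apply hi
    simpa using congrArg Subtype.val h
  obtain ⟨m, hm⟩ : ∃ m, Module.finrank ℚ V = m + 1 := ⟨_, (Nat.succ_pred_eq_of_pos hd).symm⟩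
  let b : Module.Basis (Fin (m + 1)) ℚ V := Module.finBasisOfFinrankEq ℚ V hm
  let e : Fin (m + 1) → ℝ := fun s => (b s : ℝ)
  have he0 : e 0 ≠ 0 := by
    intro h
    apply b.ne_zero 0
    exact Subtype.ext h
  let v : Fin N → V := fun i => ⟨θ i, Submodule.subset_span ⟨i, rfl⟩⟩
  let c : Fin N → Fin (m + 1) → ℚ := fun i s => b.repr (v i) s
  have hθ : ∀ i, θ i = ∑ s, (c i s : ℝ) * e s := by
    intro i
    have h := congrArg (fun w : V => (w : ℝ)) (b.sum_repr (v i))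
    simp only [Submodule.coe_sum, Submodule.coe_smul, Rat.smul_def] at h
    exact h.symm
  -- a common denominator for the coordinates
  set D : ℕ := ∏ i, ∏ s, (c i s).den with hDdef
  have hDpos : 0 < D := prod_pos fun i _ => prod_pos fun s _ => (c i s).pos
  have hz : ∀ i s, ∃ z : ℤ, (D : ℚ) * c i s = z := by
    intro i s
    obtain ⟨k, hk⟩ : (c i s).den ∣ D := by
      have h1 : (c i s).den ∣ ∏ s, (c i s).den :=
        dvd_prod_of_mem (fun s => (c i s).den) (mem_univ s)
      have h2 : (∏ s, (c i s).den) ∣ D :=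
        dvd_prod_of_mem (fun i => ∏ s, (c i s).den) (mem_univ i)
      exact h1.trans h2
    refine ⟨k * (c i s).num, ?_⟩
    rw [hk]
    push_cast
    rw [mul_comm ((c i s).den : ℚ), mul_assoc, Rat.den_mul_eq_num]
  choose z hz using hz
  have hzR : ∀ i s, (D : ℝ) * (c i s : ℝ) = (z i s : ℝ) := by
    intro i s
    have := congrArg (Rat.cast : ℚ → ℝ) (hz i s)
    push_cast at this
    exact this
  -- the forms in the basis, with integer coefficients
  let P : ℕ → Fin (m + 1) → ℤ := fun n s => ∑ i, p n i * z i s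
  have hPL : ∀ n, (D : ℝ) * L n = ∑ s, (P n s : ℝ) * e s := by
    intro n
    calc (D : ℝ) * L n = ∑ i, ∑ s, (p n i : ℝ) * ((D : ℝ) * (c i s : ℝ)) * e s := by
          rw [hLdef, mul_sum]
          refine sum_congr rfl fun i _ => ?_
          rw [hθ i, mul_sum, mul_sum]
          exact sum_congr rfl fun s _ => by ring
      _ = ∑ s, ∑ i, (p n i : ℝ) * (z i s : ℝ) * e s := by
          rw [sum_comm]
          exact sum_congr rfl fun s _ => sum_congr rfl fun i _ => by rw [hzR i s]
      _ = ∑ s, (P n s : ℝ) * e s := by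
          refine sum_congr rfl fun s _ => ?_
          simp only [P, Int.cast_sum, Int.cast_mul, sum_mul]
  -- normalised data
  let ξ : Fin m → ℝ := fun t => e t.succ / e 0
  let p₀' : ℕ → ℤ := fun n => P n 0
  let p' : ℕ → Fin m → ℤ := fun n t => P n t.succ
  have hL' : ∀ n, (p₀' n : ℝ) + ∑ t, (p' n t : ℝ) * ξ t = (D : ℝ) * L n / e 0 := by
    intro n
    rw [hPL n, Fin.sum_univ_succ, add_div, sum_div]
    congr 1
    · simp [p₀', he0]
    · exact sum_congr rfl fun t _ => by simp only [p', ξ]; ring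
  -- hypothesis i) for the normalised forms
  have h1' : Tendsto (fun n : ℕ => Real.log |(p₀' n : ℝ) + ∑ t, (p' n t : ℝ) * ξ t| / n)
      atTop (𝓝 (-A)) := by
    have hc : Tendsto (fun n : ℕ => Real.log |L n| / n + Real.log (D / |e 0|) / n) atTop
        (𝓝 (-A + 0)) := by
      refine Tendsto.add ?_ (tendsto_const_div_atTop_nhds_zero_nat _)
      simpa [hAdef] using h1
    rw [add_zero] at hc
    refine hc.congr' ?_
    filter_upwards [hLne] with n hn
    rw [hL' n, ← add_div]
    congr 1
    have hDr : (0 : ℝ) < D := by exact_mod_cast hDpos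
    have habs : |(D : ℝ) * L n / e 0| = |L n| * (D / |e 0|) := by
      rw [abs_div, abs_mul, Nat.abs_cast]
      ring
    rw [habs, Real.log_mul (abs_pos.2 hn).ne' (by positivity)]
  -- hypothesis ii) for the normalised forms
  have h2' : ∀ ε : ℝ, 0 < ε → ∀ᶠ n : ℕ in atTop, ∀ s, |(P n s : ℝ)| ≤ Real.exp ((B + ε) * n) := by
    intro ε hε
    set Zb : ℝ := ∑ i, ∑ s, |(z i s : ℝ)| + 1 with hZb
    have hZb1 : 1 ≤ Zb := by
      rw [hZb]
      have : 0 ≤ ∑ i, ∑ s, |(z i s : ℝ)| := sum_nonneg fun i _ => sum_nonneg fun s _ => abs_nonneg _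
      linarith
    have hZbs : ∀ s, ∑ i, |(z i s : ℝ)| ≤ Zb := fun s => by
      rw [hZb]
      have : ∑ i, |(z i s : ℝ)| ≤ ∑ i, ∑ s, |(z i s : ℝ)| :=
        sum_le_sum fun i _ => single_le_sum (f := fun s => |(z i s : ℝ)|)
          (fun s _ => abs_nonneg _) (mem_univ s)
      linarith
    have hall : ∀ᶠ n : ℕ in atTop, ∀ i, Real.log |(p n i : ℝ)| ≤ n * Real.log β + ε / 2 * n :=
      eventually_all.2 fun i => h2 i (ε / 2) (by linarith)
    have hgrow : ∀ᶠ n : ℕ in atTop, Zb ≤ Real.exp (ε / 2 * n) := by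
      have ht : Tendsto (fun n : ℕ => Real.exp (ε / 2 * n)) atTop atTop :=
        Real.tendsto_exp_atTop.comp
          ((tendsto_natCast_atTop_atTop (R := ℝ)).const_mul_atTop (by linarith))
      exact ht.eventually_ge_atTop Zb
    filter_upwards [hall, hgrow] with n hn hng s
    have hpi : ∀ i, |(p n i : ℝ)| ≤ Real.exp ((B + ε / 2) * n) := by
      intro i
      by_cases h0 : p n i = 0
      · simp [h0, (Real.exp_pos _).le]
      · have hpos : 0 < |(p n i : ℝ)| := abs_pos.2 (by exact_mod_cast h0)
        rw [← Real.exp_log hpos, Real.exp_le_exp]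
        have := hn i
        rw [hBdef]
        linarith
    calc |(P n s : ℝ)| = |∑ i, (p n i : ℝ) * z i s| := by simp [P]
      _ ≤ ∑ i, |(p n i : ℝ)| * |(z i s : ℝ)| :=
          (abs_sum_le_sum_abs _ _).trans (le_of_eq (sum_congr rfl fun i _ => abs_mul _ _))
      _ ≤ ∑ i, Real.exp ((B + ε / 2) * n) * |(z i s : ℝ)| :=
          sum_le_sum fun i _ => mul_le_mul_of_nonneg_right (hpi i) (abs_nonneg _)
      _ = Real.exp ((B + ε / 2) * n) * ∑ i, |(z i s : ℝ)| := by rw [mul_sum]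
      _ ≤ Real.exp ((B + ε / 2) * n) * Real.exp (ε / 2 * n) := by
          gcongr
          exact (hZbs s).trans hng
      _ = Real.exp ((B + ε) * n) := by rw [← Real.exp_add]; ring_nf
  have hcore := core ξ p₀' p' hA hB.le h1' (fun ε hε => (h2' ε hε).mono fun n hn t => hn t.succ)
  -- conclusion: `1 + A/B ≤ m + 1 = finrank`
  have hfin : (Module.finrank ℚ V : ℝ) = m + 1 := by
    rw [hm]
    push_cast
    ring
  rw [hfin]
  have hdiv : -Real.log α / Real.log β ≤ m := by
    rw [div_le_iff₀ hB]
    simpa [hAdef, hBdef] using hcore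
  have : 1 - Real.log α / Real.log β = 1 + -Real.log α / Real.log β := by ring
  linarith

end Literature.NumberTheory.Transcendental
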